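import Summits.BirchSwinnertonDyer.Rank1Residual.ManinAdditive.TwistOrbitManinTransportProof
import Summits.BirchSwinnertonDyer.Rank1Residual.ManinAdditive.RamifiedTwistDegreeDichotomy
import Summits.BirchSwinnertonDyer.Rank1Residual.ManinAdditive.RamifiedTwistDegreeTrichotomy
import Summits.BirchSwinnertonDyer.Rank1Residual.ManinAdditive.RamifiedTwistManinInvariance
import Literature.NumberTheory.EllipticCurves.IsogenyVariableChangeProofs
import Literature.NumberTheory.EllipticCurves.ModularDegreeQuadraticTwistValuation
import Literature.NumberTheory.EllipticCurves.ModularCurveManinSemistableLatticeFormProofs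
import Literature.NumberTheory.EllipticCurves.EichlerShimuraConstructionKernelProofs
import Literature.NumberTheory.EllipticCurves.ModularCurveManinSemistableProofs
import Literature.NumberTheory.EllipticCurves.ManinConstantQuadraticTwistAtTwoProofs
import Literature.NumberTheory.EllipticCurves.PastenHeightBoundsIsogenyProofs
import Literature.NumberTheory.EllipticCurves.RationalIsogenyDegreesProofs
import Literature.NumberTheory.EllipticCurves.EichlerShimuraConstructionProofs
import Literature.NumberTheory.EllipticCurves.Rank1Residual.GVParityTwistProofs
import Summits.BirchSwinnertonDyer.Rank1Residual.Partition.GreenbergVatsalIsogenyClassPeriod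
import Summits.BirchSwinnertonDyer.Rank1Residual.ManinAdditive.RamifiedTwistOptimalityCommutes
import HarnessLib
import HarnessLib.Audit.Tags

/-!
# §24 THE COVOLUME / INDEX ENGINE on same-level optimal twist orbits (cell `bsd-f2-manin`, E-an-26)

Cell `bsd-f2-manin` (D-0131 (3) frontier: the Manin constant at additive primes), analytic lens
(planner `bsd-f2-manin-an` g5), typed VERBATIM by the cell typer from HOME `run/shared/lean/pub/bsd-f2-manin/an/Sec24Core-g5.lean` sha16 9ed34f9b51be5933 (1181 lines, §24–§26 of the cumulative HOME `an/Sketch-an6.lean` bd37945ff22921ca over TREE imports only; farm rc 0 · 0 errors · 0 warnings · 0 sorries; MEMO-an §41–§43; CANDIDATES rows E-an-26…31), split into four chained theorem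
files `TwistOrbitIndexEngine` (§24 core) ← `TwistOrbitIndexEngineOdd` (§24 instances at `d = q*` and the
edge E-imc-2 ⇒ E-imc-7R) ← `TwistOrbitIsogenyDegree` (§25) ← `RamifiedTwistOptimalityCommutesProof` (§26,
the closer of imc's landed leaf E-imc-3b), plus the conjecture-only leaf `CommutingOrbitManinValEq.lean`
(E-an-28's open target). Nothing conjectural is asserted: every open law enters as an explicit hypothesis;
the `@[conjecture]` obligations declared in these files come with their kernel-checked `_holds`.

THIS FILE (§24 core, source lines 40–380): for optimal data `D`, `D′` at a common level with two-sided
twist steps of norm `a = ‖s‖²`, the lattice indices `m = [Λ_W : (cs/c′)Λ_{W′}]`, `m′ = [Λ_{W′} : (c′s/c)Λ_W]`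
satisfy `m·m′ = a²`, `m·deg′ = a·deg` (Mathlib covolumes + the tree's Zagier identity + Rankin–Selberg
`(f′,f′) = (f,f)`); the extreme indices are RIGID (`m = 1` or `m′ = 1` ⇒ `W ⊗ d ≅ W′` over `ℚ`), whence for
`a` prime the orbit TRICHOTOMY and «`deg′ = deg` ⟺ FLIP» (the planner's mechanism docstring follows).
-/

noncomputable section

open scoped MatrixGroups ModularForm

open CongruenceSubgroup WeierstrassCurve
  Literature.NumberTheory.DiophantineGeometry
  Literature.NumberTheory.EllipticCurves
  Literature.NumberTheory.EllipticCurves.ModularForms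

namespace Summit.BirchSwinnertonDyer.Rank1Residual.ManinAdditive

section CovolumeEngine

open scoped Pointwise

/-! ## §24 THE COVOLUME / INDEX ENGINE: on a same-level twist orbit with BOTH data lattice-optimal the
## two Zagier identities and the two twist steps force `m·deg′ = a·deg`, `m·m′ = a²` for the lattice
## INDICES `m = [Λ_W : (cs/c′)Λ_{W′}]`, `m′ = [Λ_{W′} : (c′s/c)Λ_W]` (`a = |d| = ‖s‖²`); the extreme
## indices are RIGID (`m = 1` or `m′ = 1` ⇒ `W ⊗ d ≅ W′` over `ℚ`), so on a FLIP orbit `m = m′ = a` and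
## `deg φ′ = deg φ` — the converse of §23, with no isomorphism to chase.

Mechanism (pure lattice algebra over the tree, no print beyond Zagier + Rankin–Selberg already in the tree):
optimality `Λ_W = cΛ(f)`, `Λ_{W′} = c′Λ(f′)` and the steps `sΛ(f′) ⊆ Λ(f)`, `sΛ(f) ⊆ Λ(f′)` give the two
inclusions `(cs/c′)·Λ_{W′} ⊆ Λ_W`, `(c′s/c)·Λ_W ⊆ Λ_{W′}` of finite index `m`, `m′`; Mathlib's
`ZLattice.covolume_div_covolume_eq_relIndex'` turns them into `c²a·covol′ = m·covol·c′²`,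
`c′²a·covol = m′·covol′·c²`; Zagier (`deg·covol = 4π²c²(f,f)`, tree) for both data with `(f′,f′) = (f,f)`
(`|aₙ′| = |aₙ|`, Rankin–Selberg, tree) gives `deg′·covol′·c² = deg·covol·c′²`.  Hence `mm′ = a²` and
`m·deg′ = a·deg`.  If `m = 1` then `(cs/c′)Λ_{W′} = Λ_W`, i.e. `Λ_{W′} = (c′/c)·s⁻¹Λ_W = (c′/c)·Λ_T` for
the Néron-type pair `Λ_T = s⁻¹Λ_W` of `T = W ⊗ d` (Pal's Lemma 3.1, tree): a RATIONAL homothety of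
Néron-type lattices of two `ℚ`-models, so `W′ ≅ T` over `ℚ` (the tree's short-model argument, as in §22);
`m′ = 1` likewise with ratio `c′d/c`.  [cite: ZagierCMB1985, §1 (p. 374)] [cite: Delaunay2003, Thm 1]
[cite: Pal2012, Lemma 3.1] [cite: Stevens1989, Lemma (5.4)] -/

/-- `‖t‖²·covol(Λ′) = [Λ : tΛ′]·covol(Λ)` for an inclusion `tΛ′ ⊆ Λ` of period lattices. [Mathlib] -/
theorem norm_sq_mul_covolume_eq_relIndex_mul {L L' : PeriodPair} {t : ℂ} (ht : t ≠ 0)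
    (hle : (L'.mulLeft t ht).lattice ≤ L.lattice) :
    ‖t‖ ^ 2 * ZLattice.covolume L'.lattice =
      ((L'.mulLeft t ht).lattice.toAddSubgroup.relIndex L.lattice.toAddSubgroup : ℝ) *
        ZLattice.covolume L.lattice := by
  have hpos : 0 < ZLattice.covolume L.lattice := ZLattice.covolume_pos _ _
  have hcov := ZLattice.covolume_div_covolume_eq_relIndex' (L'.mulLeft t ht).lattice L.lattice hle
  rw [L'.covolume_mulLeft_lattice t ht, div_eq_iff hpos.ne'] at hcov
  exact hcov

/-- An inclusion `tΛ′ ⊆ Λ` of period lattices of index `1` is an equality. [Mathlib] -/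
theorem mulLeft_lattice_eq_of_relIndex_eq_one {L L' : PeriodPair} {t : ℂ} (ht : t ≠ 0)
    (hle : (L'.mulLeft t ht).lattice ≤ L.lattice)
    (h1 : (L'.mulLeft t ht).lattice.toAddSubgroup.relIndex L.lattice.toAddSubgroup = 1) :
    (L'.mulLeft t ht).lattice = L.lattice := by
  refine le_antisymm hle ?_
  have h := AddSubgroup.relIndex_eq_one.mp h1
  intro z hz
  exact h hz

/-- The OPTIMALITY INCLUSION: lattice-optimal `D′` and a twist step `s·Λ(f′) ⊆ Λ(f)` give
`(c s / c′) · Λ_{W′} ⊆ Λ_W`. -/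
theorem mulLeft_lattice_le_of_optimal {W W' : WeierstrassCurve ℚ} {N N' : ℕ} [NeZero N] [NeZero N']
    (D : ModularParametrizationData W N) (D' : ModularParametrizationData W' N')
    (hD' : IsLatticeOptimal D') {s : ℂ}
    (h1 : ∀ w ∈ periodLattice D'.f, s * w ∈ periodLattice D.f)
    (ht : (D.c : ℂ) * s / (D'.c : ℂ) ≠ 0) :
    (D'.L.mulLeft ((D.c : ℂ) * s / (D'.c : ℂ)) ht).lattice ≤ D.L.lattice := by
  intro z hz
  have hc0' : (D'.c : ℂ) ≠ 0 := by
    intro h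
    apply ht
    rw [h, div_zero]
  rw [PeriodPair.mem_mulLeft_lattice] at hz
  obtain ⟨w, hw, hEq⟩ := hD' _ hz
  have hz' : z = ((D.c : ℂ) * s / (D'.c : ℂ)) * ((D'.c : ℂ) * w) := by
    rw [← hEq, mul_inv_cancel_left₀ ht]
  rw [hz', ← mul_assoc, div_mul_cancel₀ _ hc0', mul_assoc]
  exact D.smul_periodLattice_le _ (h1 w hw)

/-- ZAGIER TWICE + RANKIN–SELBERG: at a common level, `|aₙ(f′)| = |aₙ(f)|` gives
`deg′·covol(Λ_{W′})·c² = deg·covol(Λ_W)·c′²`. [cite: ZagierCMB1985, §1] [cite: Delaunay2003, Thm 1] -/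
theorem deg_mul_covolume_mul_sq_eq {W W' : WeierstrassCurve ℚ} {N : ℕ} [NeZero N]
    (D : ModularParametrizationData W N) (D' : ModularParametrizationData W' N)
    (hcoef : ∀ n : ℕ, ‖cuspCoeff D'.f n‖ = ‖cuspCoeff D.f n‖) :
    (D'.deg : ℝ) * ZLattice.covolume D'.L.lattice * (D.c : ℝ) ^ 2 =
      (D.deg : ℝ) * ZLattice.covolume D.L.lattice * (D'.c : ℝ) ^ 2 := by
  have hP := peterssonProduct_re_eq_of_norm_cuspCoeff_eq D.f D'.f hcoef
  rw [D.deg_mul_covolume_eq_re, D'.deg_mul_covolume_eq_re, hP]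
  ring

/-- **THE INDEX ENGINE.** Same level, both data lattice-optimal, two-sided twist steps with `‖s‖² = a`,
`|aₙ(f′)| = |aₙ(f)|`: the indices `m = [Λ_W : (cs/c′)Λ_{W′}]`, `m′ = [Λ_{W′} : (c′s/c)Λ_W]` satisfy
`m·m′ = a²` and `m·deg′ = a·deg`. -/
theorem optimal_orbit_index_engine {W W' : WeierstrassCurve ℚ} [W.IsElliptic] [W'.IsElliptic]
    {N N' : ℕ} [NeZero N] [NeZero N'] (hNN : N' = N) (D : ModularParametrizationData W N)
    (D' : ModularParametrizationData W' N') (hD : IsLatticeOptimal D) (hD' : IsLatticeOptimal D')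
    {s : ℂ} {a : ℕ} (ha : ‖s‖ ^ 2 = a)
    (h1 : ∀ w ∈ periodLattice D'.f, s * w ∈ periodLattice D.f)
    (h2 : ∀ w ∈ periodLattice D.f, s * w ∈ periodLattice D'.f)
    (hcoef : ∀ n : ℕ, ‖cuspCoeff D'.f n‖ = ‖cuspCoeff D.f n‖)
    (ht : (D.c : ℂ) * s / (D'.c : ℂ) ≠ 0) (ht' : (D'.c : ℂ) * s / (D.c : ℂ) ≠ 0) :
    (D'.L.mulLeft _ ht).lattice.toAddSubgroup.relIndex D.L.lattice.toAddSubgroup *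
        (D.L.mulLeft _ ht').lattice.toAddSubgroup.relIndex D'.L.lattice.toAddSubgroup = a ^ 2 ∧
      (D'.L.mulLeft _ ht).lattice.toAddSubgroup.relIndex D.L.lattice.toAddSubgroup * D'.modularDegree =
        a * D.modularDegree := by
  subst hNN
  set m := (D'.L.mulLeft _ ht).lattice.toAddSubgroup.relIndex D.L.lattice.toAddSubgroup with hm
  set m' := (D.L.mulLeft _ ht').lattice.toAddSubgroup.relIndex D'.L.lattice.toAddSubgroup with hm'
  have hc : (D.c : ℝ) ≠ 0 := by exact_mod_cast D.maninConstant_ne_zero_holds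
  have hc' : (D'.c : ℝ) ≠ 0 := by exact_mod_cast D'.maninConstant_ne_zero_holds
  set V := ZLattice.covolume D.L.lattice with hV
  set V' := ZLattice.covolume D'.L.lattice with hV'
  have hVpos : 0 < V := ZLattice.covolume_pos _ _
  have hV'pos : 0 < V' := ZLattice.covolume_pos _ _
  have hA := norm_sq_mul_covolume_eq_relIndex_mul ht (mulLeft_lattice_le_of_optimal D D' hD' h1 ht)
  have hA' := norm_sq_mul_covolume_eq_relIndex_mul ht' (mulLeft_lattice_le_of_optimal D' D hD h2 ht')
  rw [← hm] at hA
  rw [← hm'] at hA'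
  have hnt : ‖(D.c : ℂ) * s / (D'.c : ℂ)‖ ^ 2 = (D.c : ℝ) ^ 2 * a / (D'.c : ℝ) ^ 2 := by
    rw [norm_div, norm_mul, Complex.norm_intCast, Complex.norm_intCast, div_pow, mul_pow, sq_abs,
      sq_abs, ha]
  have hnt' : ‖(D'.c : ℂ) * s / (D.c : ℂ)‖ ^ 2 = (D'.c : ℝ) ^ 2 * a / (D.c : ℝ) ^ 2 := by
    rw [norm_div, norm_mul, Complex.norm_intCast, Complex.norm_intCast, div_pow, mul_pow, sq_abs,
      sq_abs, ha]
  rw [hnt, div_mul_eq_mul_div, div_eq_iff (pow_ne_zero 2 hc')] at hA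
  rw [hnt', div_mul_eq_mul_div, div_eq_iff (pow_ne_zero 2 hc)] at hA'
  -- hA : c² a V′ = m V c′² ;  hA' : c′² a V = m′ V′ c²
  have hZ := deg_mul_covolume_mul_sq_eq D D' hcoef
  -- hZ : deg′ V′ c² = deg V c′²
  have hX : (D.c : ℝ) ^ 2 * (D'.c : ℝ) ^ 2 * V * V' ≠ 0 :=
    mul_ne_zero (mul_ne_zero (mul_ne_zero (pow_ne_zero 2 hc) (pow_ne_zero 2 hc')) hVpos.ne')
      hV'pos.ne'
  constructor
  · have key : ((m * m' : ℕ) : ℝ) * ((D.c : ℝ) ^ 2 * (D'.c : ℝ) ^ 2 * V * V') =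
        ((a ^ 2 : ℕ) : ℝ) * ((D.c : ℝ) ^ 2 * (D'.c : ℝ) ^ 2 * V * V') := by
      push_cast
      linear_combination (-((D'.c : ℝ) ^ 2 * (a : ℝ) * V)) * hA - ((m : ℝ) * V * (D'.c : ℝ) ^ 2) * hA'
    exact_mod_cast mul_right_cancel₀ hX key
  · have hY : V * (D'.c : ℝ) ^ 2 * V' * (D.c : ℝ) ^ 2 ≠ 0 :=
      mul_ne_zero (mul_ne_zero (mul_ne_zero hVpos.ne' (pow_ne_zero 2 hc')) hV'pos.ne')
        (pow_ne_zero 2 hc)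
    have key : ((m * D'.modularDegree : ℕ) : ℝ) * (V * (D'.c : ℝ) ^ 2 * V' * (D.c : ℝ) ^ 2) =
        ((a * D.modularDegree : ℕ) : ℝ) * (V * (D'.c : ℝ) ^ 2 * V' * (D.c : ℝ) ^ 2) := by
      push_cast
      rw [ModularParametrizationData.modularDegree, ModularParametrizationData.modularDegree]
      linear_combination (-((D'.deg : ℝ) * V' * (D.c : ℝ) ^ 2)) * hA + ((a : ℝ) * (D.c : ℝ) ^ 2 * V') * hZ
    exact_mod_cast mul_right_cancel₀ hY key

/-- **RIGIDITY OF THE EXTREME INDEX.** If the Néron lattice of `W′` is a RATIONAL multiple `r` of the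
Néron-type pair `s⁻¹Λ_W` of the twisted model `W ⊗ d` (`s² = d`) — membership form
`z ∈ Λ_{W′} ↔ s·r⁻¹·z ∈ Λ_W` — then `W ⊗ d ≅ W′` over `ℚ` (the tree's short-model argument, as §22).
[cite: Pal2012, Lemma 3.1] [cite: SilvermanAEC2009, III.1, VI.5.1.1] -/
theorem exists_smul_quadraticTwist_eq_of_mem_iff {W W' : WeierstrassCurve ℚ} [W.IsElliptic]
    [W'.IsElliptic] {N N' : ℕ} [NeZero N] [NeZero N'] (D : ModularParametrizationData W N)
    (D' : ModularParametrizationData W' N') {d : ℚ} (hd : d ≠ 0) {s : ℂ} (hs0 : s ≠ 0)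
    (hs : s ^ 2 = (d : ℂ)) {r : ℚ} (hr : r ≠ 0)
    (hmem : ∀ z : ℂ, z ∈ D'.L.lattice ↔ s * (((r : ℚ) : ℂ)⁻¹ * z) ∈ D.L.lattice) :
    ∃ u : VariableChange ℚ, u • W.quadraticTwist d = W' := by
  classical
  haveI := W.isElliptic_quadraticTwist hd
  have hr0 : ((r : ℚ) : ℂ) ≠ 0 := by exact_mod_cast hr
  have hLT := WeierstrassCurve.isNeronLatticeOf_quadraticTwist_of_sq_eq d D.isNeronLattice hs0 hs
  have hΛ' : D'.L.lattice =
      ((D.L.mulLeft s⁻¹ (inv_ne_zero hs0)).mulLeft ((r : ℚ) : ℂ) hr0).lattice := by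
    ext z
    rw [hmem z, PeriodPair.mem_mulLeft_lattice, PeriodPair.mem_mulLeft_lattice, inv_inv]
  have hS' : (D'.L.lattice : Set ℂ) = ((r : ℚ) : ℂ) •
      ((D.L.mulLeft s⁻¹ (inv_ne_zero hs0)).lattice.toAddSubgroup : Set ℂ) := by
    rw [hΛ', coe_mulLeft_lattice_eq_smul, Submodule.coe_toAddSubgroup]
  have hST : ((D.L.mulLeft s⁻¹ (inv_ne_zero hs0)).lattice : Set ℂ) =
      ((1 : ℚ) : ℂ) • ((D.L.mulLeft s⁻¹ (inv_ne_zero hs0)).lattice.toAddSubgroup : Set ℂ) := by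
    rw [Rat.cast_one, one_smul, Submodule.coe_toAddSubgroup]
  obtain ⟨a₄, a₆, C₁, hW', hg₂, hg₃⟩ :=
    exists_shortModel_of_lattice_eq_smul D'.isNeronLattice hr hS' (L' := _) rfl
  obtain ⟨a₄', a₆', C₂, hT, hg₂', hg₃'⟩ :=
    exists_shortModel_of_lattice_eq_smul hLT one_ne_zero hST (L' := _) rfl
  have ha₄ : a₄' = a₄ := by
    have h : (-4 : ℂ) * a₄' = -4 * a₄ := hg₂'.symm.trans hg₂
    exact_mod_cast mul_left_cancel₀ (by norm_num : (-4 : ℂ) ≠ 0) h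
  have ha₆ : a₆' = a₆ := by
    have h : (-4 : ℂ) * a₆' = -4 * a₆ := hg₃'.symm.trans hg₃
    exact_mod_cast mul_left_cancel₀ (by norm_num : (-4 : ℂ) ≠ 0) h
  rw [ha₄, ha₆] at hT
  exact ⟨C₁⁻¹ * C₂, by rw [mul_smul, hT, ← hW', inv_smul_smul]⟩

/-- **THE MANIN–DISCRIMINANT IDENTITY of a rational homothety onto the twisted pair.** Under the
membership form `z ∈ Λ_{W′} ↔ s·r⁻¹·z ∈ Λ_W` (`s² = d`, `r ∈ ℚˣ`): `r¹² Δ(W′) = d⁶ Δ(W)` — from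
`Δ(W′) = r⁻¹²Δ(s⁻¹Λ_W)` (`IsNeronLatticeOf.Δ_eq_of_lattice_eq_mulLeft`) and `Δ(s⁻¹Λ_W) = Δ(W ⊗ d) = d⁶Δ(W)`
(the §22 template `negOne_optimal_c_pow_twelve_mul_Δ_eq`, general `d`, `r`).
[cite: SilvermanAEC2009, III.1 (1728Δ = c₄³ − c₆²)] [cite: Pal2012, Lemma 3.1] -/
theorem pow_twelve_mul_Δ_eq_of_mem_iff {W W' : WeierstrassCurve ℚ} [W.IsElliptic]
    [W'.IsElliptic] {N N' : ℕ} [NeZero N] [NeZero N'] (D : ModularParametrizationData W N)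
    (D' : ModularParametrizationData W' N') {d : ℚ} {s : ℂ} (hs0 : s ≠ 0)
    (hs : s ^ 2 = (d : ℂ)) {r : ℚ} (hr : r ≠ 0)
    (hmem : ∀ z : ℂ, z ∈ D'.L.lattice ↔ s * (((r : ℚ) : ℂ)⁻¹ * z) ∈ D.L.lattice) :
    r ^ 12 * W'.Δ = d ^ 6 * W.Δ := by
  have hr0 : ((r : ℚ) : ℂ) ≠ 0 := by exact_mod_cast hr
  have hLT := WeierstrassCurve.isNeronLatticeOf_quadraticTwist_of_sq_eq d D.isNeronLattice hs0 hs
  have hΛ' : D'.L.lattice =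
      ((D.L.mulLeft s⁻¹ (inv_ne_zero hs0)).mulLeft ((r : ℚ) : ℂ) hr0).lattice := by
    ext z
    rw [hmem z, PeriodPair.mem_mulLeft_lattice, PeriodPair.mem_mulLeft_lattice, inv_inv]
  have hΔ' := IsNeronLatticeOf.Δ_eq_of_lattice_eq_mulLeft D'.isNeronLattice hr0 hΛ'
  have hΛT : (D.L.mulLeft s⁻¹ (inv_ne_zero hs0)).lattice =
      ((D.L.mulLeft s⁻¹ (inv_ne_zero hs0)).mulLeft 1 one_ne_zero).lattice := by
    ext z
    rw [PeriodPair.mem_mulLeft_lattice (c := 1), inv_one, one_mul]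
  have hΔT := IsNeronLatticeOf.Δ_eq_of_lattice_eq_mulLeft hLT one_ne_zero hΛT
  rw [one_pow, inv_one, one_mul, quadraticTwist_Δ] at hΔT
  push_cast at hΔT
  have key : ((r : ℚ) : ℂ) ^ 12 * (W'.Δ : ℂ) = (d : ℂ) ^ 6 * (W.Δ : ℂ) := by
    rw [hΔ', ← mul_assoc, mul_inv_cancel₀ (pow_ne_zero _ hr0), one_mul, ← hΔT]
  exact_mod_cast key

/-- **THE OPTIMAL-ORBIT TRICHOTOMY WITH ITS MANIN–DISCRIMINANT IDENTITIES (orbit form; any twisting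
parameter with `‖s‖² = a` PRIME, `s² = d`).** Same level, both data lattice-optimal, two-sided twist steps,
`|aₙ(f′)| = |aₙ(f)|`.  With `m = [Λ_W : (cs/c′)Λ_{W′}]`, `m′ = [Λ_{W′} : (c′s/c)Λ_W]` (`m·m′ = a²`):
* `m = 1`: `W ⊗ d ≅ W′` over `ℚ`, `deg′ = a·deg`, and `c′¹² Δ(W′) = c¹² d⁶ Δ(W)`;
* `m′ = 1`: `W ⊗ d ≅ W′` over `ℚ`, `a·deg′ = deg`, and `c′¹² d⁶ Δ(W′) = c¹² Δ(W)`;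
* `m = m′ = a` (FLIP index): `deg φ′ = deg φ`. -/
theorem optimal_orbit_trichotomy_full {W W' : WeierstrassCurve ℚ} [W.IsElliptic] [W'.IsElliptic]
    {N N' : ℕ} [NeZero N] [NeZero N'] (hNN : N' = N) (D : ModularParametrizationData W N)
    (D' : ModularParametrizationData W' N') (hD : IsLatticeOptimal D) (hD' : IsLatticeOptimal D')
    {d : ℚ} (hd : d ≠ 0) {s : ℂ} (hs0 : s ≠ 0) (hs : s ^ 2 = (d : ℂ)) {a : ℕ} (hpr : a.Prime)
    (ha : ‖s‖ ^ 2 = a)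
    (h1 : ∀ w ∈ periodLattice D'.f, s * w ∈ periodLattice D.f)
    (h2 : ∀ w ∈ periodLattice D.f, s * w ∈ periodLattice D'.f)
    (hcoef : ∀ n : ℕ, ‖cuspCoeff D'.f n‖ = ‖cuspCoeff D.f n‖) :
    ((∃ u : VariableChange ℚ, u • W.quadraticTwist d = W') ∧
        D'.modularDegree = a * D.modularDegree ∧
        (D'.c : ℚ) ^ 12 * W'.Δ = (D.c : ℚ) ^ 12 * (d ^ 6 * W.Δ)) ∨
    ((∃ u : VariableChange ℚ, u • W.quadraticTwist d = W') ∧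
        a * D'.modularDegree = D.modularDegree ∧
        (D'.c : ℚ) ^ 12 * (d ^ 6 * W'.Δ) = (D.c : ℚ) ^ 12 * W.Δ) ∨
    (D'.modularDegree = D.modularDegree ∧
      (D'.L.mulLeft ((D.c : ℂ) * s / (D'.c : ℂ))
          (div_ne_zero (mul_ne_zero D.cast_c_ne_zero hs0) D'.cast_c_ne_zero)).lattice.toAddSubgroup.relIndex
        D.L.lattice.toAddSubgroup = a ∧
      (D.L.mulLeft ((D'.c : ℂ) * s / (D.c : ℂ))
          (div_ne_zero (mul_ne_zero D'.cast_c_ne_zero hs0) D.cast_c_ne_zero)).lattice.toAddSubgroup.relIndex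
        D'.L.lattice.toAddSubgroup = a) := by
  have hc0 : (D.c : ℂ) ≠ 0 := D.cast_c_ne_zero
  have hc0' : (D'.c : ℂ) ≠ 0 := D'.cast_c_ne_zero
  have hcq : (D.c : ℚ) ≠ 0 := by exact_mod_cast (Int.cast_ne_zero.mp hc0)
  have hcq' : (D'.c : ℚ) ≠ 0 := by exact_mod_cast (Int.cast_ne_zero.mp hc0')
  have ht : (D.c : ℂ) * s / (D'.c : ℂ) ≠ 0 := div_ne_zero (mul_ne_zero hc0 hs0) hc0'
  have ht' : (D'.c : ℂ) * s / (D.c : ℂ) ≠ 0 := div_ne_zero (mul_ne_zero hc0' hs0) hc0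
  obtain ⟨hmm, hmdeg⟩ := optimal_orbit_index_engine hNN D D' hD hD' ha h1 h2 hcoef ht ht'
  set m := (D'.L.mulLeft _ ht).lattice.toAddSubgroup.relIndex D.L.lattice.toAddSubgroup with hm
  set m' := (D.L.mulLeft _ ht').lattice.toAddSubgroup.relIndex D'.L.lattice.toAddSubgroup with hm'
  have ha0 : a ≠ 0 := hpr.ne_zero
  have hdvd : m ∣ a ^ 2 := Dvd.intro _ hmm
  obtain ⟨k, hk, hmk⟩ := (Nat.dvd_prime_pow hpr).mp hdvd
  interval_cases k
  · -- `m = 1`: `(cs/c′)Λ_{W′} = Λ_W`, rigidity with ratio `r = c′/c`, `deg′ = a·deg`, `c′¹²Δ′ = c¹²d⁶Δ`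
    left
    rw [pow_zero] at hmk
    have heq := mulLeft_lattice_eq_of_relIndex_eq_one ht (mulLeft_lattice_le_of_optimal D D' hD' h1 ht)
      hmk
    have hr : (D'.c : ℚ) / (D.c : ℚ) ≠ 0 := div_ne_zero hcq' hcq
    have hmem : ∀ z : ℂ, z ∈ D'.L.lattice ↔
        s * (((((D'.c : ℚ) / (D.c : ℚ) : ℚ)) : ℂ)⁻¹ * z) ∈ D.L.lattice := fun z ↦ by
      rw [← PeriodPair.mul_mem_mulLeft_lattice (c := (D.c : ℂ) * s / (D'.c : ℂ)) (hc := ht), heq]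
      push_cast
      rw [inv_div, show s * ((D.c : ℂ) / (D'.c : ℂ) * z) = (D.c : ℂ) * s / (D'.c : ℂ) * z by ring]
    refine ⟨exists_smul_quadraticTwist_eq_of_mem_iff D D' hd hs0 hs hr hmem, ?_, ?_⟩
    · rw [hmk, one_mul] at hmdeg
      exact hmdeg
    · have h := pow_twelve_mul_Δ_eq_of_mem_iff D D' hs0 hs hr hmem
      rw [div_pow, div_mul_eq_mul_div, div_eq_iff (pow_ne_zero _ hcq)] at h
      linear_combination h
  · -- `m = a`: the flip index, `deg′ = deg`, `m′ = a`
    right; right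
    rw [pow_one] at hmk
    rw [hmk] at hmdeg hmm
    refine ⟨Nat.eq_of_mul_eq_mul_left (Nat.pos_of_ne_zero ha0) hmdeg, hmk, ?_⟩
    have h : a * m' = a * a := by rw [← sq]; exact hmm
    exact Nat.eq_of_mul_eq_mul_left (Nat.pos_of_ne_zero ha0) h
  · -- `m = a²`: then `m′ = 1`, rigidity with ratio `r = c′d/c`, `a·deg′ = deg`, `c′¹²d⁶Δ′ = c¹²Δ`
    right; left
    rw [hmk] at hmm hmdeg
    have hm'1 : m' = 1 := by
      have h : a ^ 2 * m' = a ^ 2 * 1 := by rw [mul_one]; exact hmm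
      exact Nat.eq_of_mul_eq_mul_left (pow_pos (Nat.pos_of_ne_zero ha0) 2) h
    have heq := mulLeft_lattice_eq_of_relIndex_eq_one ht' (mulLeft_lattice_le_of_optimal D' D hD h2 ht')
      hm'1
    have hr : (D'.c : ℚ) / (D.c : ℚ) * d ≠ 0 := mul_ne_zero (div_ne_zero hcq' hcq) hd
    have hmem : ∀ z : ℂ, z ∈ D'.L.lattice ↔
        s * (((((D'.c : ℚ) / (D.c : ℚ) * d : ℚ)) : ℂ)⁻¹ * z) ∈ D.L.lattice := fun z ↦ by
      rw [← heq, PeriodPair.mem_mulLeft_lattice]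
      push_cast
      have e : s * (((D'.c : ℂ) / (D.c : ℂ) * (d : ℂ))⁻¹ * z) = ((D'.c : ℂ) * s / (D.c : ℂ))⁻¹ * z := by
        rw [← hs]
        field_simp
      rw [e]
    refine ⟨exists_smul_quadraticTwist_eq_of_mem_iff D D' hd hs0 hs hr hmem, ?_, ?_⟩
    · have h : a * (a * D'.modularDegree) = a * D.modularDegree := by
        rw [← mul_assoc, ← sq]; exact hmdeg
      exact Nat.eq_of_mul_eq_mul_left (Nat.pos_of_ne_zero ha0) h
    · have h := pow_twelve_mul_Δ_eq_of_mem_iff D D' hs0 hs hr hmem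
      have e : ((D'.c : ℚ) / (D.c : ℚ) * d) ^ 12 = (D'.c : ℚ) ^ 12 * d ^ 12 / (D.c : ℚ) ^ 12 := by
        rw [mul_pow, div_pow]; ring
      rw [e, div_mul_eq_mul_div, div_eq_iff (pow_ne_zero _ hcq)] at h
      refine mul_left_cancel₀ (pow_ne_zero 6 hd) ?_
      linear_combination h

/-- **THE FLIP THEOREM (orbit form, any twisting parameter with `‖s‖² = a` PRIME, `s² = d`).** Same level,
both data lattice-optimal, two-sided twist steps, `|aₙ(f′)| = |aₙ(f)|`: EITHER `W ⊗ d ≅ W′` over `ℚ`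
(and then `deg′ = a·deg ∨ a·deg′ = deg`), OR `deg φ′ = deg φ`. -/
theorem optimal_orbit_trichotomy {W W' : WeierstrassCurve ℚ} [W.IsElliptic] [W'.IsElliptic]
    {N N' : ℕ} [NeZero N] [NeZero N'] (hNN : N' = N) (D : ModularParametrizationData W N)
    (D' : ModularParametrizationData W' N') (hD : IsLatticeOptimal D) (hD' : IsLatticeOptimal D')
    {d : ℚ} (hd : d ≠ 0) {s : ℂ} (hs0 : s ≠ 0) (hs : s ^ 2 = (d : ℂ)) {a : ℕ} (hpr : a.Prime)
    (ha : ‖s‖ ^ 2 = a)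
    (h1 : ∀ w ∈ periodLattice D'.f, s * w ∈ periodLattice D.f)
    (h2 : ∀ w ∈ periodLattice D.f, s * w ∈ periodLattice D'.f)
    (hcoef : ∀ n : ℕ, ‖cuspCoeff D'.f n‖ = ‖cuspCoeff D.f n‖) :
    ((∃ u : VariableChange ℚ, u • W.quadraticTwist d = W') ∧
        (D'.modularDegree = a * D.modularDegree ∨ a * D'.modularDegree = D.modularDegree)) ∨
      D'.modularDegree = D.modularDegree := by
  rcases optimal_orbit_trichotomy_full hNN D D' hD hD' hd hs0 hs hpr ha h1 h2 hcoef with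
    ⟨hu, hdeg, -⟩ | ⟨hu, hdeg, -⟩ | ⟨hdeg, -, -⟩
  · exact Or.inl ⟨hu, Or.inl hdeg⟩
  · exact Or.inl ⟨hu, Or.inr hdeg⟩
  · exact Or.inr hdeg

/-- **THE FLIP INDEX.** If optimality does NOT commute with the twist (`u • (W ⊗ d) ≠ W′` for every `u`),
both relative indices equal `a`: `(cs/c′)Λ_{W′}` is an index-`a` sublattice of `Λ_W` and symmetrically
(imc's «index-`q` sublattice» clause, E-imc-3b). -/
theorem optimal_flip_relIndex_eq {W W' : WeierstrassCurve ℚ} [W.IsElliptic] [W'.IsElliptic]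
    {N N' : ℕ} [NeZero N] [NeZero N'] (hNN : N' = N) (D : ModularParametrizationData W N)
    (D' : ModularParametrizationData W' N') (hD : IsLatticeOptimal D) (hD' : IsLatticeOptimal D')
    {d : ℚ} (hd : d ≠ 0) {s : ℂ} (hs0 : s ≠ 0) (hs : s ^ 2 = (d : ℂ)) {a : ℕ} (hpr : a.Prime)
    (ha : ‖s‖ ^ 2 = a)
    (h1 : ∀ w ∈ periodLattice D'.f, s * w ∈ periodLattice D.f)
    (h2 : ∀ w ∈ periodLattice D.f, s * w ∈ periodLattice D'.f)
    (hcoef : ∀ n : ℕ, ‖cuspCoeff D'.f n‖ = ‖cuspCoeff D.f n‖)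
    (hflip : ∀ u : VariableChange ℚ, u • W.quadraticTwist d ≠ W')
    (ht : (D.c : ℂ) * s / (D'.c : ℂ) ≠ 0) (ht' : (D'.c : ℂ) * s / (D.c : ℂ) ≠ 0) :
    (D'.L.mulLeft _ ht).lattice.toAddSubgroup.relIndex D.L.lattice.toAddSubgroup = a ∧
      (D.L.mulLeft _ ht').lattice.toAddSubgroup.relIndex D'.L.lattice.toAddSubgroup = a := by
  rcases optimal_orbit_trichotomy_full hNN D D' hD hD' hd hs0 hs hpr ha h1 h2 hcoef with
    ⟨⟨u, hu⟩, -⟩ | ⟨⟨u, hu⟩, -⟩ | ⟨-, hm, hm'⟩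
  · exact absurd hu (hflip u)
  · exact absurd hu (hflip u)
  · exact ⟨hm, hm'⟩

/-- **FLIP ⇒ `deg φ′ = deg φ`** (the converse of §23's degree jump). -/
theorem optimal_flip_modularDegree_eq {W W' : WeierstrassCurve ℚ} [W.IsElliptic] [W'.IsElliptic]
    {N N' : ℕ} [NeZero N] [NeZero N'] (hNN : N' = N) (D : ModularParametrizationData W N)
    (D' : ModularParametrizationData W' N') (hD : IsLatticeOptimal D) (hD' : IsLatticeOptimal D')
    {d : ℚ} (hd : d ≠ 0) {s : ℂ} (hs0 : s ≠ 0) (hs : s ^ 2 = (d : ℂ)) {a : ℕ} (hpr : a.Prime)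
    (ha : ‖s‖ ^ 2 = a)
    (h1 : ∀ w ∈ periodLattice D'.f, s * w ∈ periodLattice D.f)
    (h2 : ∀ w ∈ periodLattice D.f, s * w ∈ periodLattice D'.f)
    (hcoef : ∀ n : ℕ, ‖cuspCoeff D'.f n‖ = ‖cuspCoeff D.f n‖)
    (hflip : ∀ u : VariableChange ℚ, u • W.quadraticTwist d ≠ W') :
    D'.modularDegree = D.modularDegree := by
  rcases optimal_orbit_trichotomy hNN D D' hD hD' hd hs0 hs hpr ha h1 h2 hcoef with ⟨⟨u, hu⟩, _⟩ | h
  · exact absurd hu (hflip u)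
  · exact h

end CovolumeEngine

end Summit.BirchSwinnertonDyer.Rank1Residual.ManinAdditive

end
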